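/-
Origin: expansion seat `planner-pub-hodgecm-pv13-g5-0`, handover #2 2026-08-18T12:5xZ (md5 ddb86af1315499bf8f58c189cc10a9f3 v2; NEW additive leaf; THREE import rewrites by the generic ^import Pv[0-9]+g[0-9]+\. -> import HodgeCM.PerL34. rule: Pv13g5.RestrictedTensorL2 (my #1), Pv13g4.GenuineSchrodingerModel (RUN 29 row 6d0063d7), Pv09g6.GenuineTensorModel (RUN 29 row 49f3d512); land AFTER all three) (`HOME/pub-hodgecm-pv13-g5/lean/Pv13g5/GenuineSchrodingerTensor.lean`, md5 ddb86af1, 397 lines);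
landed by the gen-8 packager in gate run 30 as `HodgeCM/PerL34/GenuineSchrodingerTensor.lean` (import ^import Pv13g5\.RestrictedTensorL2[ \t]*$→import HodgeCM.PerL34.RestrictedTensorL2 ×1; import ^import Pv09g6\.GenuineTensorModel[ \t]*$→import HodgeCM.PerL34.GenuineTensorModel ×1; import ^import Pv13g4\.GenuineSchrodingerModel[ \t]*$→import HodgeCM.PerL34.GenuineSchrodingerModel ×1).
-/
/-
Copyright: HodgeCM publication cell (pub-hodgecm), seam S3 (𝓕-side / genuine idelic torus end).  Prover seat
pub-hodgecm-pv13-g5 (DAG-node prover #13, generation 5), file #2; intended final place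
`HodgeCM/PerL34/GenuineSchrodingerTensor.lean`.  WIP imports: `Pv13g5.RestrictedTensorL2` ↦
`HodgeCM.PerL34.RestrictedTensorL2` (this seat, file #1), `Pv13g4.GenuineSchrodingerModel` ↦
`HodgeCM.PerL34.GenuineSchrodingerModel` (pv13-g4 #6, RUN 29), `Pv09g6.GenuineTensorModel` ↦
`HodgeCM.PerL34.GenuineTensorModel` (pv09-g6 #2, RUN 29).  Complete proofs, no new axioms, nothing cited.
-/
import Summits.HodgeConjecture.HodgeCM.PerL34.RestrictedTensorL2
import Summits.HodgeConjecture.HodgeCM.PerL34.GenuineSchrodingerModel_2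
import Summits.HodgeConjecture.HodgeCM.PerL34.GenuineTensorModel_2

/-!
# The global split Schrödinger model `L²(X)` CONTAINS the restricted tensor product `⊗′_v L²((L⁺_v)³)`

Kernel meaning, for the genuine S3 models of this package, of PerL v5 l. 600 "`φ = ⊗_v φ_v` is a pure tensor"
and of "`𝒮(𝔸³) = ⊗′_v 𝒮(F_v³)`" at the `L²` level: for a CM field `L`, with `X = Πʳ_{v split} [(L⁺_v)³, 𝒪_v³]`,
`dx` the Haar measure with `vol(∏ 𝒪_v³) = 1` (pv13-g4 `GenuineSchrodingerModel`) and `dx_v` the local Haar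
measures with `vol(𝒪_v³) = 1`:

* `tensorIso L : ⊗′_v (L²((L⁺_v)³, dx_v), 1_{𝒪_v³}) →ₗᵢ[ℂ] L²(X, dx)` — THE linear isometry
  `⊗_v f_v ↦ (x ↦ ∏_v f_v(x_v))` (file #1 `RestrictedTensor.tensorToL2` specialised);
* `tensorIso_vac` — the vacuum `⊗_v 1_{𝒪_v³}` goes to pv13-g4's distinguished vector `φ⁰ = 1_{∏ 𝒪_v³}`;
* `tensorIso_slot` — the slot embedding `f ↦ ⊗(f at v, 1_{𝒪_w³} elsewhere)` goes to pv13-g4's coordinate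
  intertwiner `V_v f`;
* `rep_tensorIso` — **equivariance**: `ω(k) ∘ tensorIso = tensorIso ∘ (⊗′_v ω_v)(k)` for EVERY `k` in the
  model group `U(1)(𝔸_{L⁺})`, where `ω = rep L 1` is pv13-g4's global split Schrödinger representation on
  `L²(X)` and `⊗′_v ω_v` is pv09-g6's restricted tensor product (`RestrictedTensor.rep`) of the local dilation
  representations `ω_v(g) f (y) = |λ|^{3/2} f(λ y)`, `λ = baseTriv(g)`, at the split places;
* `sqrt_distribHaarChar_eq_prod` / `distribHaarChar_eq_prod` / `weight_eq_prod` — on the way, **the modulus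
  of the adelic action FACTORISES**: `δ_X(k) = ∏_{v ∈ T} δ_v(k_v)` for every finite `T` outside which `k` acts by
  norm-one units (`δ_v(k_v) = |λ_v|_v³`, pv07-g2), proved WITHOUT any Haar-measure computation on `X`: the two
  sides of the equivariance (`coeFn_rep_prodLp`, `coeFn_prodLp_gact`) are nonnegative real multiples
  `δ_X(k)^{1/2}`, `∏ δ_v(k_v)^{1/2}` of ONE function, and both have the norm of the argument (unitarity +
  `norm_prodLp`), so the scalars agree;
* `inner_rep_tensorIso_tp` — hence the matrix coefficients of pure tensors FACTORISE over the split places: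
  `⟪ω(k) (⊗ f_v), ⊗ g_v⟫ = ∏_v ⟪ω_v(k_v) f_v, g_v⟫`.

So the `⊗′` model (pv09-g6) at the split places IS the sub-representation of the `L²(X)` model (pv13-g4)
generated by the product functions.  NO statement of PerL / QW8 / the 2001 programme is cited or used.
-/

set_option autoImplicit false

noncomputable section

open MeasureTheory MeasureTheory.Measure Set Metric Function Complex ComplexConjugate Topology Filter
open scoped RestrictedProduct InnerProductSpace NNReal ENNReal

namespace HodgeCM.PerL34.PureTensor.SchrodingerModel

open HodgeCM.PerL34.LocalFactors HodgeCM.PerL34.LocalFactors.DilationModel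
open HodgeCM.PerL34.IdelePlaces HodgeCM.PerL34.IdelicTorusModel HodgeCM.PerL34.IdelicTorusModel.Genuine
open HodgeCM.PerL34.RestrictedTensor HodgeCM.PerL34.RestrictedTensor.ProdL2 NumberField IsDedekindDomain

attribute [local instance] LocalFactors.DilationModel.Adic.nontriviallyNormedField
  LocalFactors.DilationModel.Adic.properSpace

variable {L : Type} [Field L] [NumberField L] [IsCMField L]

local notation3 "L⁺" => maximalRealSubfield L

variable [∀ v : HeightOneSpectrum (𝓞 (maximalRealSubfield L)), MeasurableSpace (v.adicCompletion (maximalRealSubfield L))]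
  [∀ v : HeightOneSpectrum (𝓞 (maximalRealSubfield L)), BorelSpace (v.adicCompletion (maximalRealSubfield L))]

/-! ## §1  The isometric embedding `⊗′_v L²((L⁺_v)³) ↪ L²(X)` -/

variable (L) in
/-- the local Haar measures `dx_v` on `(L⁺_v)³`, `vol(𝒪_v³) = 1`, indexed by the split indices -/
abbrev mloc (i : SplitIdx L) : Measure (Coord L i) := Adic.muV L⁺ (basePlaceOf L i.1)

/-- (Ported verbatim from the HodgeCMPerL package; no docstring in the source.) -/
theorem mloc_cube (i : SplitIdx L) : mloc L i (cube L i : Set (Coord L i)) = 1 := by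
  rw [mloc, Adic.muV, coe_cube]
  exact addHaarMeasure_self

omit [∀ v : HeightOneSpectrum (𝓞 (maximalRealSubfield L)), MeasurableSpace (v.adicCompletion (maximalRealSubfield L))]
  [∀ v : HeightOneSpectrum (𝓞 (maximalRealSubfield L)), BorelSpace (v.adicCompletion (maximalRealSubfield L))] in
variable (L) in
/-- (Ported verbatim from the HodgeCMPerL package; no docstring in the source.) -/
theorem μ_boxSet : μ L (boxSet (cube L)) = 1 := μ_box L

variable (L) in
/-- the unit family `(L²((L⁺_v)³, dx_v), 1_{𝒪_v³})_{v split}` -/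
abbrev locFam : UnitFamily (fun i : SplitIdx L => Lp ℂ 2 (mloc L i)) := l2Family (cube L) (mloc L) mloc_cube

/-- its reference vectors are pv09-g6's / pv13-g4's `1_{𝒪_v³}` -/
theorem locFam_e (i : SplitIdx L) : (locFam L).e i = ballIndicator (mloc L i) 0 1 := rfl

variable (L) in
/-- **`⊗′_v L²((L⁺_v)³) ↪ L²(X)`**: the linear isometry `⊗_v f_v ↦ (x ↦ ∏_v f_v(x_v))` -/
def tensorIso : RestrictedTensor.Space (locFam L) →ₗᵢ[ℂ] Lp ℂ 2 (μ L) :=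
  tensorToL2 (μ L) (μ_boxSet L) (mloc L) mloc_cube

/-- on a pure tensor: `tensorIso (⊗ f) = 1_{cyl_T} ∏_{v ∈ T} f_v(x_v)` for any finite `T` outside which
`f_v = 1_{𝒪_v³}` -/
theorem tensorIso_tp (x : RVec (locFam L)) (T : Finset (SplitIdx L))
    (hT : ∀ i ∉ T, x i = ballIndicator (mloc L i) 0 1) :
    tensorIso L (tp (locFam L) x) = prodLp (μ L) (μ_boxSet L) (mloc L) mloc_cube T x :=
  tensorToL2_tp_eq_prodLp _ _ _ _ x T hT

/-- a.e. formula on a pure tensor -/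
theorem coeFn_tensorIso_tp (x : RVec (locFam L)) (T : Finset (SplitIdx L))
    (hT : ∀ i ∉ T, x i = ballIndicator (mloc L i) 0 1) :
    ⇑(tensorIso L (tp (locFam L) x)) =ᵐ[μ L] (cylSet (cube L) T).indicator
      fun w => ∏ i : T, (x i.1 : Coord L i.1 → ℂ) (w i.1) :=
  coeFn_tensorToL2_tp _ _ _ _ x T hT

/-- **the vacuum is the distinguished vector**: `tensorIso (⊗_v 1_{𝒪_v³}) = φ⁰ = 1_{∏_v 𝒪_v³}` -/
theorem tensorIso_vac : tensorIso L (tp (locFam L) (RVec.vac _)) = phi0 L := by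
  rw [tensorIso, tensorToL2_vac]
  rfl

/-- (Ported verbatim from the HodgeCMPerL package; no docstring in the source.) -/
theorem cylSet_singleton (i : SplitIdx L) : cylSet (cube L) {i} = cyl L i := by
  ext x
  simp only [mem_cylSet_iff, Finset.mem_singleton, mem_cyl_iff, SetLike.mem_coe]

section Slot

variable [DecidableEq (Place (maximalRealSubfield L))]

/-- **the slot embeddings are the coordinate intertwiners**:
`tensorIso (f ⊗ ⊗_{w ≠ v} 1_{𝒪_w³}) = V_v f` (`= 1_{cyl v}(x) f(x_v)`) -/
theorem tensorIso_slot (i : SplitIdx L) (f : Lp ℂ 2 (mloc L i)) :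
    tensorIso L (tp (locFam L) ((RVec.vac (locFam L)).update i f)) = V i f := by
  have hT : ∀ j ∉ ({i} : Finset (SplitIdx L)), (RVec.vac (locFam L)).update i f j = ballIndicator (mloc L j) 0 1 :=
    fun j hj => by
      rw [RVec.update_apply_of_ne _ (fun h => hj (Finset.mem_singleton.2 h))]
      rfl
  refine Lp.ext_iff.2 ?_
  filter_upwards [coeFn_tensorIso_tp _ {i} hT, coeFn_V i f] with w h1 h2
  rw [h1, h2, cylSet_singleton]
  refine congr_fun (congr_arg _ (funext fun w => ?_)) w
  rw [Finset.prod_coe_sort {i} fun j => ((RVec.vac (locFam L)).update i f j : Coord L j → ℂ) (w j),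
    Finset.prod_singleton, RVec.update_apply_same]

/-- so `tensorIso ∘ slot_v = V_v` as linear isometries from `L²((L⁺_v)³)` -/
theorem tensorIso_comp_slot (i : SplitIdx L) :
    (tensorIso L).comp (slot (locFam L) (RVec.vac _) (fun j => (locFam L).norm_e j) i) = V i :=
  LinearIsometry.ext fun f => tensorIso_slot i f

end Slot

/-! ## §2  Equivariance under the model group `U(1)(𝔸_{L⁺})`

`k ∈ U(1)(𝔸_{L⁺})` acts on `L²(X)` by pv13-g4's `ω(k) = rep L 1 k`, `(ω(k) f)(x) = δ(k)^{1/2} f(k • x)`, and on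
`⊗′_v L²((L⁺_v)³)` by pv09-g6's restricted tensor product of the local dilation representations
`ω_v(k_v) f (y) = |λ_v|^{3/2} f(λ_v y)`, `λ_v = baseTriv(k_v) ∈ (L⁺_v)ˣ` (admissible: `ω_v(B_v)` fixes `1_{𝒪_v³}`).
The embedding `tensorIso` intertwines the two. -/

section Equivariance

/-- the local representation at a split index `v`: `U_v → (L⁺_v)ˣ → U(L²((L⁺_v)³))`, `λ ↦ (f ↦ |λ|^{3/2} f(λ ·))`
(`baseTriv` followed by pv07-g2's `dilationRep`, trivial twist) -/
def ρloc (i : SplitIdx L) : locTorus L⁺ L i.1 →* (Lp ℂ 2 (mloc L i) ≃ₗᵢ[ℂ] Lp ℂ 2 (mloc L i)) :=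
  (dilationRep (mloc L i) (1 : ((basePlaceOf L i.1).adicCompletion L⁺)ˣ →* Circle)).comp
    (baseTriv L i.1 i.2 : locTorus L⁺ L i.1 →* ((basePlaceOf L i.1).adicCompletion L⁺)ˣ)

/-- (Ported verbatim from the HodgeCMPerL package; no docstring in the source.) -/
theorem ρloc_apply (i : SplitIdx L) (g : locTorus L⁺ L i.1) :
    ρloc i g = dilationRep (mloc L i) (1 : ((basePlaceOf L i.1).adicCompletion L⁺)ˣ →* Circle)
      (baseTriv L i.1 i.2 g) :=
  rfl

/-- **admissibility**: `ω_v(B_v)` fixes `1_{𝒪_v³}` at every split `v` (`baseTriv(B_v) = 𝒪_vˣ`, norm-one units) -/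
theorem admissible_ρloc : Admissible (locFam L) (fun i : SplitIdx L => genLevel L i.1) (ρloc (L := L)) :=
  Eventually.of_forall fun i b hb => by
    rw [ρloc_apply, locFam_e]
    exact dilationRep_ballIndicator_zero (mloc L i) 1 _ ((mem_genLevel_iff_norm_baseTriv_eq_one L i.1 i.2 b).1 hb)
      rfl 1

variable (L) in
/-- the split part `k ↦ (k_v)_{v split}` of the model group, into `Πʳ_{v split} [U_v, B_v]` -/
def splitPart : Model L →* Πʳ i : SplitIdx L, [locTorus L⁺ L i.1, genLevel L i.1] :=
  RestrictedProduct.mapAlongMonoidHom (fun v : Place L⁺ => locTorus L⁺ L v)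
    (fun i : SplitIdx L => locTorus L⁺ L i.1) Subtype.val Subtype.val_injective.tendsto_cofinite
    (fun i : SplitIdx L => MonoidHom.id (locTorus L⁺ L i.1)) (Eventually.of_forall fun _ _ hx => hx)

omit [∀ v : HeightOneSpectrum (𝓞 (maximalRealSubfield L)), MeasurableSpace (v.adicCompletion (maximalRealSubfield L))]
  [∀ v : HeightOneSpectrum (𝓞 (maximalRealSubfield L)), BorelSpace (v.adicCompletion (maximalRealSubfield L))] in
/-- (Ported verbatim from the HodgeCMPerL package; no docstring in the source.) -/
@[simp] theorem splitPart_apply (k : Model L) (i : SplitIdx L) : splitPart L k i = k i.1 := rfl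

variable (L) in
/-- **`⊗′_v ω_v`** as a representation of the model group on `⊗′_v L²((L⁺_v)³)` (pv09-g6 `RestrictedTensor.rep`
along the split part) -/
def repTensor : Model L →* (RestrictedTensor.Space (locFam L) ≃ₗᵢ[ℂ] RestrictedTensor.Space (locFam L)) :=
  (RestrictedTensor.rep admissible_ρloc).comp (splitPart L)

/-- (Ported verbatim from the HodgeCMPerL package; no docstring in the source.) -/
theorem repTensor_apply (k : Model L) : repTensor L k = RestrictedTensor.rep admissible_ρloc (splitPart L k) := rfl

/-- `(⊗′ ω_v)(k) (⊗ f_v) = ⊗ ω_v(k_v) f_v` -/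
theorem repTensor_tp (k : Model L) (x : RVec (locFam L)) :
    repTensor L k (tp (locFam L) x) = tp (locFam L) (gact admissible_ρloc (splitPart L k) x) :=
  RestrictedTensor.rep_tp _ _ _

/-- (Ported verbatim from the HodgeCMPerL package; no docstring in the source.) -/
theorem gact_splitPart_apply (k : Model L) (x : RVec (locFam L)) (i : SplitIdx L) :
    gact admissible_ρloc (splitPart L k) x i
      = dilationRep (mloc L i) (1 : ((basePlaceOf L i.1).adicCompletion L⁺)ˣ →* Circle) (unitAt k i) (x i) :=
  rfl

omit [∀ v : HeightOneSpectrum (𝓞 (maximalRealSubfield L)), MeasurableSpace (v.adicCompletion (maximalRealSubfield L))]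
  [∀ v : HeightOneSpectrum (𝓞 (maximalRealSubfield L)), BorelSpace (v.adicCompletion (maximalRealSubfield L))] in
/-- the cylinder `cyl_T` is stable under `k` as soon as `k` acts by norm-one units off `T` -/
theorem smul_mem_cylSet_iff (k : Model L) (T : Finset (SplitIdx L))
    (hk : ∀ j ∉ T, ‖((unitAt k j : ((basePlaceOf L j.1).adicCompletion L⁺)ˣ) : (basePlaceOf L j.1).adicCompletion L⁺)‖ = 1)
    (w : Space L) : k • w ∈ cylSet (cube L) T ↔ w ∈ cylSet (cube L) T := by
  simp only [mem_cylSet_iff, SetLike.mem_coe]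
  refine forall₂_congr fun j hj => ?_
  rw [smul_apply, mem_cube_iff, mem_cube_iff, norm_smul, hk j hj, one_mul]

/-- for every pure tensor and every `k` there is a finite `T` outside which the slots are the reference vectors AND
`k` acts by norm-one units -/
theorem exists_finset (k : Model L) (x : RVec (locFam L)) :
    ∃ T : Finset (SplitIdx L), (∀ i ∉ T, x i = ballIndicator (mloc L i) 0 1) ∧
      ∀ i ∉ T, ‖((unitAt k i : ((basePlaceOf L i.1).adicCompletion L⁺)ˣ) : (basePlaceOf L i.1).adicCompletion L⁺)‖ = 1 := by
  have h := eventually_cofinite.1 (x.eventually_eq.and (eventually_norm_unitAt_eq_one k))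
  refine ⟨h.toFinset, fun i hi => ?_, fun i hi => ?_⟩ <;>
    have hi' := not_not.1 fun hn => hi (h.mem_toFinset.2 hn)
  exacts [hi'.1, hi'.2]

/-- the common a.e. shape of `ω(k)(1_{cyl_T} ∏ f_v(x_v))` and `1_{cyl_T} ∏ (ω_v(k_v) f_v)(x_v)`: the function
`1_{cyl_T}(x) · ∏_{v ∈ T} f_v(λ_v x_v)`, `λ_v = unitAt k v` -/
def twistFun (k : Model L) (T : Finset (SplitIdx L)) (x : RVec (locFam L)) : Space L → ℂ :=
  (cylSet (cube L) T).indicator fun w => ∏ i : T, (x i.1 : Coord L i.1 → ℂ)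
    (((unitAt k i.1 : ((basePlaceOf L i.1.1).adicCompletion L⁺)ˣ) : (basePlaceOf L i.1.1).adicCompletion L⁺) • w i.1)

/-- (L) `ω(k) (1_{cyl_T} ∏_{v∈T} f_v(x_v)) = δ_X(k)^{1/2} · 1_{cyl_T}(x) ∏_{v∈T} f_v(λ_v x_v)` a.e., for `T` outside which `k`
acts by norm-one units (so that `k • cyl_T = cyl_T`) -/
theorem coeFn_rep_prodLp (k : Model L) (T : Finset (SplitIdx L))
    (hk : ∀ j ∉ T, ‖((unitAt k j : ((basePlaceOf L j.1).adicCompletion L⁺)ˣ) : (basePlaceOf L j.1).adicCompletion L⁺)‖ = 1)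
    (x : RVec (locFam L)) :
    ⇑(rep L 1 k (prodLp (μ L) (μ_boxSet L) (mloc L) mloc_cube T x)) =ᵐ[μ L]
      fun w => ((NNReal.sqrt (distribHaarChar (Space L) k) : ℝ) : ℂ) * twistFun k T x w := by
  have hwa : weight (Space L) (1 : Model L →* Circle) k = ((NNReal.sqrt (distribHaarChar (Space L) k) : ℝ) : ℂ) := by
    rw [weight, MonoidHom.one_apply, Circle.coe_one, one_mul]
  have h1 := coeFn_dilationRep (μ L) (1 : Model L →* Circle) k (prodLp (μ L) (μ_boxSet L) (mloc L) mloc_cube T x)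
  have h2 := (quasiMeasurePreserving_smul' (μ L) k).ae_eq_comp
    (coeFn_prodLp (μ L) (μ_boxSet L) (mloc L) mloc_cube T x)
  filter_upwards [h1, h2] with w e1 e2
  simp only [Function.comp_def] at e2
  rw [e1, e2, hwa, twistFun]
  congr 1
  by_cases hw : w ∈ cylSet (cube L) T
  · rw [indicator_of_mem ((smul_mem_cylSet_iff k T hk w).2 hw), indicator_of_mem hw]
    rfl
  · rw [indicator_of_notMem (mt (smul_mem_cylSet_iff k T hk w).1 hw), indicator_of_notMem hw]

/-- (R) `1_{cyl_T} ∏_{v∈T} (ω_v(k_v) f_v)(x_v) = (∏_{v∈T} δ_v(k_v)^{1/2}) · 1_{cyl_T}(x) ∏_{v∈T} f_v(λ_v x_v)` a.e. -/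
theorem coeFn_prodLp_gact (k : Model L) (T : Finset (SplitIdx L)) (x : RVec (locFam L)) :
    ⇑(prodLp (μ L) (μ_boxSet L) (mloc L) mloc_cube T (gact admissible_ρloc (splitPart L k) x)) =ᵐ[μ L]
      fun w => ((∏ i ∈ T, (NNReal.sqrt (distribHaarChar (Coord L i)
        (unitAt k i : ((basePlaceOf L i.1).adicCompletion L⁺)ˣ)) : ℝ) : ℝ) : ℂ) * twistFun k T x w := by
  have hwb : ∀ i : T, weight (Coord L i.1) (1 : ((basePlaceOf L i.1.1).adicCompletion L⁺)ˣ →* Circle) (unitAt k i.1)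
      = ((NNReal.sqrt (distribHaarChar (Coord L i.1) (unitAt k i.1 : ((basePlaceOf L i.1.1).adicCompletion L⁺)ˣ)) : ℝ) : ℂ) :=
    fun i => by rw [weight, MonoidHom.one_apply, Circle.coe_one, one_mul]
  have h3 := coeFn_prodLp (μ L) (μ_boxSet L) (mloc L) mloc_cube T (gact admissible_ρloc (splitPart L k) x)
  have h4 : ∀ i : T, ∀ᵐ w ∂(μ L), w ∈ cylSet (cube L) T →
      (gact admissible_ρloc (splitPart L k) x i.1 : Coord L i.1 → ℂ) (w i.1)
        = weight (Coord L i.1) (1 : ((basePlaceOf L i.1.1).adicCompletion L⁺)ˣ →* Circle) (unitAt k i.1)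
          * (x i.1 : Coord L i.1 → ℂ) (((unitAt k i.1 : ((basePlaceOf L i.1.1).adicCompletion L⁺)ˣ) :
            (basePlaceOf L i.1.1).adicCompletion L⁺) • w i.1) := by
    intro i
    rw [← ae_restrict_iff' (isOpen_cylSet T).measurableSet]
    have h := (quasiMeasurePreserving_apply (μ L) (μ_boxSet L) (mloc L) mloc_cube T i).ae_eq_comp
      (coeFn_dilationRep (mloc L i.1) (1 : ((basePlaceOf L i.1.1).adicCompletion L⁺)ˣ →* Circle)
        (unitAt k i.1) (x i.1))
    filter_upwards [h] with w hw
    exact hw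
  filter_upwards [h3, ae_all_iff.2 h4] with w e3 e4
  rw [e3, twistFun]
  by_cases hw : w ∈ cylSet (cube L) T
  · rw [indicator_of_mem hw, indicator_of_mem hw, Complex.ofReal_prod,
      ← Finset.prod_coe_sort T fun i => (((NNReal.sqrt (distribHaarChar (Coord L i)
        (unitAt k i : ((basePlaceOf L i.1).adicCompletion L⁺)ˣ)) : ℝ) : ℝ) : ℂ),
      ← Finset.prod_mul_distrib]
    exact Finset.prod_congr rfl fun i _ => by rw [e4 i hw, hwb i]
  · rw [indicator_of_notMem hw, indicator_of_notMem hw, mul_zero]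

/-- **the modulus of the adelic action FACTORISES**: `δ_X(k)^{1/2} = ∏_{v ∈ T} δ_v(k_v)^{1/2}` for any finite `T` outside
which `k` acts by norm-one units (`δ_v = |λ_v|_v³` by pv07-g2; the factors off `T` are `1`).  Proof: (L) and (R) for the
vacuum `⊗_v 1_{𝒪_v³}` exhibit `ω(k) φ_T` and `∏(ω_v(k_v) 1_{𝒪_v³})` as the two NONNEGATIVE REAL multiples of one function;
both have norm `1` (`ω(k)`, `ω_v(k_v)` unitary, `norm_prodLp`), so the scalars agree — no Haar-measure computation on `X`. -/
theorem sqrt_distribHaarChar_eq_prod (k : Model L) (T : Finset (SplitIdx L))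
    (hk : ∀ j ∉ T, ‖((unitAt k j : ((basePlaceOf L j.1).adicCompletion L⁺)ˣ) : (basePlaceOf L j.1).adicCompletion L⁺)‖ = 1) :
    (NNReal.sqrt (distribHaarChar (Space L) k) : ℝ)
      = ∏ i ∈ T, (NNReal.sqrt (distribHaarChar (Coord L i) (unitAt k i : ((basePlaceOf L i.1).adicCompletion L⁺)ˣ)) : ℝ) := by
  set a : ℝ := (NNReal.sqrt (distribHaarChar (Space L) k) : ℝ) with ha
  set b : ℝ := ∏ i ∈ T, (NNReal.sqrt (distribHaarChar (Coord L i)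
    (unitAt k i : ((basePlaceOf L i.1).adicCompletion L⁺)ˣ)) : ℝ) with hb
  have ha0 : 0 < a := NNReal.coe_pos.2 (NNReal.sqrt_pos.2 (distribHaarChar_pos))
  have hb0 : 0 ≤ b := Finset.prod_nonneg fun i _ => NNReal.coe_nonneg _
  -- the vacuum product function `φ_T = 1_{cyl_T} ∏_{v∈T} 1_{𝒪_v³}` and its image
  set F := prodLp (μ L) (μ_boxSet L) (mloc L) mloc_cube T (RVec.vac (locFam L)) with hF
  set H := prodLp (μ L) (μ_boxSet L) (mloc L) mloc_cube T (gact admissible_ρloc (splitPart L k) (RVec.vac (locFam L)))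
    with hH
  have hF1 : ‖rep L 1 k F‖ = 1 := by
    rw [LinearIsometryEquiv.norm_map, hF, norm_prodLp]
    exact Finset.prod_eq_one fun i _ => (locFam L).norm_e i
  have hH1 : ‖H‖ = 1 := by
    rw [hH, norm_prodLp]
    exact Finset.prod_eq_one fun i _ => by rw [gact_splitPart_apply, LinearIsometryEquiv.norm_map]; exact (locFam L).norm_e i
  -- `H = (b/a) • ω(k) F` in `L²`
  have hHF : H = ((b / a : ℝ) : ℂ) • rep L 1 k F := by
    refine Lp.ext_iff.2 ?_
    filter_upwards [coeFn_rep_prodLp k T hk (RVec.vac _), coeFn_prodLp_gact k T (RVec.vac _),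
      Lp.coeFn_smul (((b / a : ℝ) : ℂ)) (rep L 1 k F : Lp ℂ 2 (μ L))] with w eL eR eS
    rw [eS, Pi.smul_apply, eL, eR, smul_eq_mul, ← mul_assoc, ← Complex.ofReal_mul, div_mul_cancel₀ b ha0.ne']
  -- norms: `1 = (b/a) · 1`
  have key : ∀ (G : Lp ℂ 2 (μ L)) (c : ℝ), 0 ≤ c → ‖G‖ = 1 → ‖(c : ℂ) • G‖ = 1 → c = 1 := by
    intro G c hc hG h
    rwa [norm_smul, Complex.norm_real, Real.norm_of_nonneg hc, hG, mul_one] at h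
  rw [hHF] at hH1
  have h1 := key _ _ (div_nonneg hb0 ha0.le) hF1 hH1
  rw [div_eq_one_iff_eq ha0.ne'] at h1
  exact h1.symm

/-- `δ_X(k) = ∏_{v ∈ T} δ_v(k_v)` (= `∏_v |λ_v|_v³`, pv07-g2 `distribHaarChar` of a dilation) -/
theorem distribHaarChar_eq_prod (k : Model L) (T : Finset (SplitIdx L))
    (hk : ∀ j ∉ T, ‖((unitAt k j : ((basePlaceOf L j.1).adicCompletion L⁺)ˣ) : (basePlaceOf L j.1).adicCompletion L⁺)‖ = 1) :
    distribHaarChar (Space L) k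
      = ∏ i ∈ T, distribHaarChar (Coord L i) (unitAt k i : ((basePlaceOf L i.1).adicCompletion L⁺)ˣ) := by
  have h := sqrt_distribHaarChar_eq_prod k T hk
  rw [← NNReal.coe_prod, NNReal.coe_inj] at h
  rw [← NNReal.mul_self_sqrt (distribHaarChar (Space L) k), h, ← Finset.prod_mul_distrib]
  exact Finset.prod_congr rfl fun i _ => NNReal.mul_self_sqrt _

/-- the weights agree: `δ_X(k)^{1/2} = ∏_{v∈T} δ_v(k_v)^{1/2}` as the scalars of `ω(k)` and `⊗_v ω_v(k_v)` -/
theorem weight_eq_prod (k : Model L) (T : Finset (SplitIdx L))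
    (hk : ∀ j ∉ T, ‖((unitAt k j : ((basePlaceOf L j.1).adicCompletion L⁺)ˣ) : (basePlaceOf L j.1).adicCompletion L⁺)‖ = 1) :
    weight (Space L) (1 : Model L →* Circle) k
      = ∏ i ∈ T, weight (Coord L i) (1 : ((basePlaceOf L i.1).adicCompletion L⁺)ˣ →* Circle)
          (unitAt k i : ((basePlaceOf L i.1).adicCompletion L⁺)ˣ) := by
  simp only [weight, MonoidHom.one_apply, Circle.coe_one, one_mul]
  rw [sqrt_distribHaarChar_eq_prod k T hk, Complex.ofReal_prod]

/-- **equivariance on product functions**: for `T` outside which `k` acts by norm-one units,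
`ω(k) (1_{cyl_T} ∏_{v∈T} f_v(x_v)) = 1_{cyl_T} ∏_{v∈T} (ω_v(k_v) f_v)(x_v)` — by (L), (R) and the factorisation of the
modulus. -/
theorem rep_prodLp (k : Model L) (T : Finset (SplitIdx L))
    (hk : ∀ j ∉ T, ‖((unitAt k j : ((basePlaceOf L j.1).adicCompletion L⁺)ˣ) : (basePlaceOf L j.1).adicCompletion L⁺)‖ = 1)
    (x : RVec (locFam L)) :
    rep L 1 k (prodLp (μ L) (μ_boxSet L) (mloc L) mloc_cube T x)
      = prodLp (μ L) (μ_boxSet L) (mloc L) mloc_cube T (gact admissible_ρloc (splitPart L k) x) := by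
  refine Lp.ext_iff.2 ((coeFn_rep_prodLp k T hk x).trans ?_)
  rw [sqrt_distribHaarChar_eq_prod k T hk]
  exact (coeFn_prodLp_gact k T x).symm

/-- **equivariance on pure tensors**: `ω(k) (tensorIso (⊗ f_v)) = tensorIso ((⊗′ ω_v)(k) (⊗ f_v))` -/
theorem rep_tensorIso_tp (k : Model L) (x : RVec (locFam L)) :
    rep L 1 k (tensorIso L (tp (locFam L) x)) = tensorIso L (repTensor L k (tp (locFam L) x)) := by
  obtain ⟨T, hx, hk⟩ := exists_finset k x
  have hy : ∀ i ∉ T, gact admissible_ρloc (splitPart L k) x i = ballIndicator (mloc L i) 0 1 := fun i hi => by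
    rw [gact_splitPart_apply, hx i hi]
    exact dilationRep_ballIndicator_zero (mloc L i) 1 _ (hk i hi) rfl 1
  rw [repTensor_tp, tensorIso_tp x T hx, tensorIso_tp _ T hy]
  exact rep_prodLp k T hk x

/-- **EQUIVARIANCE**: `ω(k) ∘ tensorIso = tensorIso ∘ (⊗′_v ω_v)(k)` on all of `⊗′_v L²((L⁺_v)³)`, for every `k`
in the model group — the `⊗′` model is a sub-representation of the `L²(X)` model. -/
theorem rep_tensorIso (k : Model L) (z : RestrictedTensor.Space (locFam L)) :
    rep L 1 k (tensorIso L z) = tensorIso L (repTensor L k z) := by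
  have h := clm_ext (𝓔 := locFam L)
    (A := ((rep L 1 k).toContinuousLinearEquiv : Lp ℂ 2 (μ L) →L[ℂ] Lp ℂ 2 (μ L)).comp
      (tensorIso L).toContinuousLinearMap)
    (A' := (tensorIso L).toContinuousLinearMap.comp
      ((repTensor L k).toContinuousLinearEquiv : RestrictedTensor.Space (locFam L) →L[ℂ] RestrictedTensor.Space (locFam L)))
    fun x => by
      show rep L 1 k (tensorIso L (tp (locFam L) x)) = tensorIso L (repTensor L k (tp (locFam L) x))
      exact rep_tensorIso_tp k x
  exact DFunLike.congr_fun h z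

/-- the range of `tensorIso` is an `ω`-INVARIANT closed subspace of `L²(X)` -/
theorem rep_mem_range_tensorIso (k : Model L) {F : Lp ℂ 2 (μ L)} (hF : F ∈ Set.range (tensorIso L)) :
    rep L 1 k F ∈ Set.range (tensorIso L) := by
  obtain ⟨z, rfl⟩ := hF
  exact ⟨repTensor L k z, (rep_tensorIso k z).symm⟩


-- port_pkg: scope closed for this part
end Equivariance
end HodgeCM.PerL34.PureTensor.SchrodingerModel
end
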